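import Summits.HodgeConjecture.CorCM.GaloisSectionCountFixed
import Mathlib.GroupTheory.Coset.Card
import Mathlib.GroupTheory.GroupAction.Quotient
import Mathlib.Tactic.Group
import HarnessLib

/-!
# A NON-CENTRAL INVOLUTION yields a SKEW CM set (trivial left stabiliser, non-trivial right stabiliser) — the group core

COR-CM (cell `pub-hodgecm2`), binder seat b04 (gen 32), count-neutral own lane «Galois-CM-type classification».  KERNEL ONLY,
Mathlib only: theorems; no definition, no named fact, no `sorry`.  Sequel of `CorCM/GaloisSectionCountFixed` (the counting) and
feeder of `CorCM/GaloisNonCentralInvolution` (the Galois dress through gen 23's `GaloisModels.exists_simple_degenerate_of_model_skew`: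
a skew CM set is read by a PRIMITIVE DEGENERATE CM type).

SETTING.  `G` finite, `c ∈ Z(G)` an involution (complex conjugation), `u ∈ G` an involution which is NOT central.  Put
`H = {1, u, c, cu}` (a Klein four-group, `= Subgroup.closure {u, c}`), `P = G/H` (left cosets, `|P| = |G|/4`), `rep : P → G`
representatives.  Every `x ∈ G` is `rep(x̄)·w` with `w ∈ H`; call `x` UPPER if `w ∈ {c, cu}`.  For `ε : P → Bool` let
`T_ε = {x : upper(x) = ε(x̄)}`.  Then (§2) `T_ε` is a CM set for `c` (`x ↦ cx` flips upper), `T_ε u = T_ε` (`x ↦ xu` keeps upper),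
and `v T_ε = T_ε` forces the TWISTED SYSTEM `ε(v·q) = ε(q) ⊻ α_v(q)`, `α_v(q) = upper(v·rep q)`, on `P`.  A fixed point `q` of
`v` with `α_v(q) = false` means `rep(q) u rep(q)⁻¹ = v` (§3), and these fibres of `q ↦ rep(q) u rep(q)⁻¹` (a `G`-equivariant map
onto the conjugacy class of `u`, which has `≥ 2` elements) occupy at most HALF of `P`.  So `CorCM/GaloisSectionCountFixed` bounds the
`v`-stable `ε`; summing `2^((|P| + F_v)/2)` over `v` with `Σ_v F_v = |P|`, `F_v ≤ |P|/2` stays below `2^|P|` once `|P| ≥ 16`: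

* **`exists_skew_of_noncentral_involution`** — `|G| ≥ 64` ⟹ there is `T ⊆ G` with `x ∈ T ↔ cx ∉ T`, trivial left stabiliser,
  and `Tu = T`.
(The bound `64` is what the count gives; the seat's census finds skew sets of this shape already for `S₃ × C₄`, order 24.)

## References

* [Shimura1998] G. Shimura, *Abelian Varieties with Complex Multiplication and Modular Functions*, §8.2 Prop. 26, §32.10 (context:
  left stabiliser = automorphisms of the type, right stabiliser = reflex degeneracy).
-/

namespace Summit.HodgeConjecture.CorCM.GaloisModels.SkewSection

open Finset

variable {G : Type*} [Group G]

/-! ## §1 The four-group `{1, u, c, cu}` and an arithmetic lemma -/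

/-- For commuting involutions `u, c`: `Subgroup.closure {u, c} = {1, u, c, cu}`. [folklore] -/
theorem mem_closure_pair_iff {c u : G} (hcc : c * c = 1) (huu : u * u = 1) (hcu : c * u = u * c) (x : G) :
    x ∈ Subgroup.closure ({u, c} : Set G) ↔ (x = 1 ∨ x = u ∨ x = c ∨ x = c * u) := by
  have hu' : u⁻¹ = u := inv_eq_of_mul_eq_one_right huu
  have hc' : c⁻¹ = c := inv_eq_of_mul_eq_one_right hcc
  have r1 : u * (c * u) = c := by rw [← mul_assoc, ← hcu, mul_assoc, huu, mul_one]
  have r2 : c * (c * u) = u := by rw [← mul_assoc, hcc, one_mul]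
  have r3 : c * u * u = c := by rw [mul_assoc, huu, mul_one]
  have r4 : c * u * c = u := by rw [mul_assoc, ← hcu, ← mul_assoc, hcc, one_mul]
  have r5 : c * u * (c * u) = 1 := by rw [← mul_assoc, r4, huu]
  have r6 : u * c = c * u := hcu.symm
  constructor
  · intro hx
    induction hx using Subgroup.closure_induction with
    | mem x hx =>
      simp only [Set.mem_insert_iff, Set.mem_singleton_iff] at hx
      rcases hx with rfl | rfl
      · exact Or.inr (Or.inl rfl)
      · exact Or.inr (Or.inr (Or.inl rfl))
    | one => exact Or.inl rfl
    | mul x y _ _ ihx ihy =>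
      rcases ihx with rfl | rfl | rfl | rfl <;> rcases ihy with rfl | rfl | rfl | rfl <;>
        simp [huu, hcc, r1, r2, r3, r4, r5, r6]
    | inv x _ ih =>
      rcases ih with rfl | rfl | rfl | rfl
      · exact Or.inl inv_one
      · exact Or.inr (Or.inl hu')
      · exact Or.inr (Or.inr (Or.inl hc'))
      · right; right; right; rw [mul_inv_rev, hu', hc', r6]
  · rintro (rfl | rfl | rfl | rfl)
    · exact one_mem _
    · exact Subgroup.subset_closure (by simp)
    · exact Subgroup.subset_closure (by simp)
    · exact mul_mem (Subgroup.subset_closure (by simp)) (Subgroup.subset_closure (by simp))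

/-- The counting inequality behind the skew-section theorem: for `n ≥ 16`,
`4n·2^(n/2) + n·2^((n+3)/2) + (n/4)·2^((n + n/2)/2) < 2^n` (each summand is at most `2^(n-2)`). [folklore] -/
theorem skew_count_lt_two_pow (n : ℕ) (hn : 16 ≤ n) :
    4 * n * 2 ^ (n / 2) + n * 2 ^ ((n + 3) / 2) + n / 4 * 2 ^ ((n + n / 2) / 2) < 2 ^ n := by
  have pow32 : ∀ m : ℕ, 8 ≤ m → 32 * m ≤ 2 ^ m := by
    intro m hm
    induction m, hm using Nat.le_induction with
    | base => norm_num
    | succ m _ ih => rw [pow_succ]; omega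
  have pow8 : ∀ m : ℕ, 7 ≤ m → 16 * m + 12 ≤ 2 ^ m := by
    intro m hm
    induction m, hm using Nat.le_induction with
    | base => norm_num
    | succ m _ ih => rw [pow_succ]; omega
  have powk : ∀ k : ℕ, 4 ≤ k → 4 * k ≤ 2 ^ k := by
    intro k hk
    induction k, hk using Nat.le_induction with
    | base => norm_num
    | succ k _ ih => rw [pow_succ]; omega
  have hsplit : ∀ e : ℕ, e ≤ n → 2 ^ e * 2 ^ (n - e) = 2 ^ n := fun e he => by
    rw [← pow_add, Nat.add_sub_cancel' he]
  -- term 1: `4n·2^(n/2) ≤ 2^(n-2)`, from `16 n ≤ 32 (n - n/2) ≤ 2^(n - n/2)`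
  have t1 : 4 * n * 2 ^ (n / 2) * 4 ≤ 2 ^ n := by
    have h := pow32 (n - n / 2) (by omega)
    calc 4 * n * 2 ^ (n / 2) * 4 = 16 * n * 2 ^ (n / 2) := by ring
      _ ≤ 2 ^ (n - n / 2) * 2 ^ (n / 2) := Nat.mul_le_mul_right _ (by omega)
      _ = 2 ^ n := by rw [mul_comm, hsplit (n / 2) (Nat.div_le_self n 2)]
  -- term 2: `n·2^((n+3)/2) ≤ 2^(n-2)`, from `4n ≤ 2^(n - (n+3)/2)` (exponent `= n/2 - 1 ≥ 7`)
  have t2 : n * 2 ^ ((n + 3) / 2) * 4 ≤ 2 ^ n := by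
    have he : (n + 3) / 2 ≤ n := by omega
    have h := pow8 (n - (n + 3) / 2) (by omega)
    calc n * 2 ^ ((n + 3) / 2) * 4 = 4 * n * 2 ^ ((n + 3) / 2) := by ring
      _ ≤ 2 ^ (n - (n + 3) / 2) * 2 ^ ((n + 3) / 2) := Nat.mul_le_mul_right _ (by omega)
      _ = 2 ^ n := by rw [mul_comm, hsplit _ he]
  -- term 3: `(n/4)·2^((n + n/2)/2) ≤ 2^(n-2)`, from `n/4 ≤ 2^(n/4 - 2) ≤ 2^(n - 2 - (n + n/2)/2)`
  have t3 : n / 4 * 2 ^ ((n + n / 2) / 2) * 4 ≤ 2 ^ n := by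
    have he : (n + n / 2) / 2 ≤ n := by omega
    have hk := powk (n / 4) (by omega)
    have hexp : n / 4 ≤ n - (n + n / 2) / 2 := by omega
    calc n / 4 * 2 ^ ((n + n / 2) / 2) * 4 = 4 * (n / 4) * 2 ^ ((n + n / 2) / 2) := by ring
      _ ≤ 2 ^ (n / 4) * 2 ^ ((n + n / 2) / 2) := Nat.mul_le_mul_right _ hk
      _ ≤ 2 ^ (n - (n + n / 2) / 2) * 2 ^ ((n + n / 2) / 2) :=
          Nat.mul_le_mul_right _ (Nat.pow_le_pow_right two_pos hexp)
      _ = 2 ^ n := by rw [mul_comm, hsplit _ he]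
  have hpos : 0 < 2 ^ n := pow_pos two_pos n
  omega

/-! ## §2–§4 The skew section -/

variable [Fintype G] [DecidableEq G]

/-- **A NON-CENTRAL INVOLUTION YIELDS A SKEW CM SET** (`|G| ≥ 64`): for a central involution `c` and a non-central involution `u`
there is `T ⊆ G` with `x ∈ T ↔ cx ∉ T` (CM for `c`), trivial LEFT stabiliser, and `T u = T` (non-trivial RIGHT stabiliser).
[cite: Shimura1998, §8.2 Prop. 26] -/
theorem exists_skew_of_noncentral_involution (c u : G) (hcc : c * c = 1) (hc1 : c ≠ 1) (hcen : ∀ g : G, c * g = g * c)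
    (huu : u * u = 1) (hu1 : u ≠ 1) (hnc : ∃ g : G, g * u ≠ u * g) (hbig : 64 ≤ Fintype.card G) :
    ∃ T : Finset G, (∀ x, x ∈ T ↔ c * x ∉ T) ∧ (∀ v : G, v ≠ 1 → ∃ w, ¬ (w ∈ T ↔ v * w ∈ T)) ∧
      (∀ x, x * u ∈ T ↔ x ∈ T) := by
  classical
  -- relations
  have huc : u ≠ c := fun h => by obtain ⟨g, hg⟩ := hnc; exact hg (by rw [h, hcen])
  have hcu : c * u = u * c := hcen u
  have hcu1 : c * u ≠ 1 := fun h => huc (by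
    have := congrArg (c * ·) h; simp only [← mul_assoc, hcc, one_mul, mul_one] at this; exact this)
  have hcuc : c * u ≠ c := fun h => hu1 (mul_left_cancel (h.trans (mul_one c).symm))
  have hcuu : c * u ≠ u := fun h => hc1 (mul_right_cancel (h.trans (one_mul u).symm))
  have r1 : u * (c * u) = c := by rw [← mul_assoc, ← hcu, mul_assoc, huu, mul_one]
  have r2 : c * (c * u) = u := by rw [← mul_assoc, hcc, one_mul]
  have r3 : c * u * u = c := by rw [mul_assoc, huu, mul_one]
  have r4 : c * u * c = u := by rw [mul_assoc, ← hcu, ← mul_assoc, hcc, one_mul]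
  have r5 : c * u * (c * u) = 1 := by rw [← mul_assoc, r4, huu]
  have r6 : u * c = c * u := hcu.symm
  -- the four-group and the coset space
  set H : Subgroup G := Subgroup.closure ({u, c} : Set G) with hHdef
  have hH : ∀ x, x ∈ H ↔ (x = 1 ∨ x = u ∨ x = c ∨ x = c * u) := mem_closure_pair_iff hcc huu hcu
  have hHcomm : ∀ w, w ∈ H → w * u = u * w := by
    intro w hw; rcases (hH w).1 hw with rfl | rfl | rfl | rfl
    · rw [one_mul, mul_one]
    · rfl
    · exact hcu
    · rw [r3, r1]
  haveI : Fintype (G ⧸ H) := Fintype.ofFinite _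
  set rep : G ⧸ H → G := Quotient.out with hrepdef
  have hrep : ∀ q : G ⧸ H, ((rep q : G) : G ⧸ H) = q := fun q => Quotient.out_eq q
  have hcoe : ∀ y w : G, w ∈ H → ((y * w : G) : G ⧸ H) = (y : G ⧸ H) := fun y w hw =>
    (QuotientGroup.eq.2 (by rw [inv_mul_cancel_left]; exact hw)).symm
  have hrepH : ∀ x : G, (rep (x : G ⧸ H))⁻¹ * x ∈ H := fun x => QuotientGroup.eq.1 (hrep _)
  -- the character `χ` of `H` with kernel `{1, u}` and the «upper» predicate
  set χ : G → Bool := fun w => decide (w = c ∨ w = c * u) with hχ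
  have hχmul : ∀ h w, h ∈ H → w ∈ H → χ (h * w) = xor (χ h) (χ w) := by
    intro h w hh hw
    rcases (hH h).1 hh with rfl | rfl | rfl | rfl <;> rcases (hH w).1 hw with rfl | rfl | rfl | rfl <;>
      simp [hχ, huu, hcc, r1, r2, r3, r4, r5, r6, hc1.symm, hcu1.symm, huc, hcuc, hcuc.symm, hcuu.symm]
  set up : G → Bool := fun x => χ ((rep (x : G ⧸ H))⁻¹ * x) with hup
  have hupmul : ∀ y w : G, w ∈ H → up (y * w) = xor (up y) (χ w) := by
    intro y w hw
    simp only [hup]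
    rw [hcoe y w hw, ← mul_assoc]
    exact hχmul _ _ (hrepH y) hw
  have huprep : ∀ q : G ⧸ H, up (rep q) = false := by
    intro q
    have e : rep ((rep q : G) : G ⧸ H) = rep q := by rw [hrep]
    simp only [hup, e, inv_mul_cancel, hχ, hc1.symm, hcu1.symm, or_self, decide_false]
  have huH : u ∈ H := (hH u).2 (Or.inr (Or.inl rfl))
  have hcH : c ∈ H := (hH c).2 (Or.inr (Or.inr (Or.inl rfl)))
  have hχu : χ u = false := by simp [hχ, huc, hcuu.symm]
  have hχc : χ c = true := by simp [hχ]
  -- the section sets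
  have hT : ∀ (ε : G ⧸ H → Bool) (x : G), x ∈ (Finset.univ.filter fun y : G => up y = ε (y : G ⧸ H)) ↔ up x = ε x :=
    fun ε x => by rw [Finset.mem_filter, and_iff_right (Finset.mem_univ x)]
  -- (a) right `u`-invariance, (b) CM for `c`
  have hTu : ∀ (ε : G ⧸ H → Bool) (x : G), x * u ∈ (Finset.univ.filter fun y : G => up y = ε (y : G ⧸ H)) ↔
      x ∈ (Finset.univ.filter fun y : G => up y = ε (y : G ⧸ H)) := by
    intro ε x; rw [hT, hT, hupmul x u huH, hχu, Bool.xor_false, hcoe x u huH]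
  have hTc : ∀ (ε : G ⧸ H → Bool) (x : G), x ∈ (Finset.univ.filter fun y : G => up y = ε (y : G ⧸ H)) ↔
      c * x ∉ (Finset.univ.filter fun y : G => up y = ε (y : G ⧸ H)) := by
    intro ε x
    rw [hT, hT, hcen x, hupmul x c hcH, hχc, Bool.xor_true, hcoe x c hcH]
    cases up x <;> cases ε (x : G ⧸ H) <;> simp
  -- (c) a left stabiliser `v` forces the twisted system
  have hstab : ∀ (ε : G ⧸ H → Bool) (v : G),
      (∀ x, x ∈ (Finset.univ.filter fun y : G => up y = ε (y : G ⧸ H)) ↔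
        v * x ∈ (Finset.univ.filter fun y : G => up y = ε (y : G ⧸ H))) →
      ∀ q : G ⧸ H, ε (v • q) = xor (ε q) (up (v * rep q)) := by
    intro ε v hv q
    have e1 : ((v * rep q : G) : G ⧸ H) = v • q := by rw [← smul_eq_mul, ← MulAction.Quotient.smul_coe, hrep]
    have h1 := hv (rep q)
    rw [hT, hT, huprep, hrep, e1] at h1
    have h2 := hv (rep q * c)
    rw [hT, hT, hupmul _ c hcH, huprep, hχc, hcoe _ c hcH, hrep, ← mul_assoc, hupmul _ c hcH, hχc,
      hcoe _ c hcH, e1] at h2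
    revert h1 h2
    cases ε q <;> cases ε (v • q) <;> cases up (v * rep q) <;> simp
  -- (d) fixed points with trivial twist lie in a fibre of `q ↦ rep q · u · (rep q)⁻¹`
  have hfix : ∀ (v : G), v ≠ 1 → ∀ q : G ⧸ H, v • q = q → up (v * rep q) = false → rep q * u * (rep q)⁻¹ = v := by
    intro v hv q hq hupv
    have e1 : ((v * rep q : G) : G ⧸ H) = v • q := by rw [← smul_eq_mul, ← MulAction.Quotient.smul_coe, hrep]
    have hw : (rep q)⁻¹ * (v * rep q) ∈ H := by
      have := hrepH (v * rep q); rwa [e1, hq] at this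
    have hup' : up (v * rep q) = χ ((rep q)⁻¹ * (v * rep q)) := by simp only [hup, e1, hq]
    rw [hup'] at hupv
    rcases (hH _).1 hw with h | h | h | h
    · exfalso; apply hv
      have := congrArg (rep q * ·) h
      simp only [mul_inv_cancel_left, mul_one] at this
      exact mul_right_cancel (this.trans (one_mul (rep q)).symm)
    · have := congrArg (fun z => rep q * z * (rep q)⁻¹) h
      simp only [mul_inv_cancel_left, mul_inv_cancel_right] at this
      exact this.symm
    · rw [h] at hupv; simp [hχ] at hupv
    · rw [h] at hupv; simp [hχ] at hupv
  -- (e) every fibre occupies at most half of `P`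
  have hfibre : ∀ v : G, 2 * (Finset.univ.filter fun q : G ⧸ H => rep q * u * (rep q)⁻¹ = v).card ≤
      Fintype.card (G ⧸ H) := by
    intro v
    by_cases hne : (Finset.univ.filter fun q : G ⧸ H => rep q * u * (rep q)⁻¹ = v) = ∅
    · rw [hne, Finset.card_empty]; exact Nat.zero_le _
    obtain ⟨q₀, hq₀⟩ := Finset.nonempty_iff_ne_empty.2 hne
    have hv : rep q₀ * u * (rep q₀)⁻¹ = v := (Finset.mem_filter.1 hq₀).2
    -- `v` is not central
    have hvnc : ∃ g : G, g * v ≠ v * g := by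
      by_contra hall
      have hall' : ∀ g : G, g * v = v * g := fun g => by by_contra h; exact hall ⟨g, h⟩
      have h4 : v * rep q₀ = rep q₀ * u := by rw [← hv, inv_mul_cancel_right]
      have hvu : v = u := mul_left_cancel ((hall' (rep q₀)).trans h4)
      obtain ⟨g, hg⟩ := hnc
      exact hg (by rw [← hvu]; exact hall' g)
    obtain ⟨g, hg⟩ := hvnc
    have hne' : g * v * g⁻¹ ≠ v := fun h => hg (by
      have := congrArg (· * g) h; simp only [inv_mul_cancel_right] at this; exact this)
    -- the injection `q ↦ g • q` from the fibre of `v` into the fibre of `g v g⁻¹`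
    have hmap : ∀ q ∈ (Finset.univ.filter fun q : G ⧸ H => rep q * u * (rep q)⁻¹ = v),
        g • q ∈ (Finset.univ.filter fun q : G ⧸ H => rep q * u * (rep q)⁻¹ = g * v * g⁻¹) := by
      intro q hq
      have hq' : rep q * u * (rep q)⁻¹ = v := (Finset.mem_filter.1 hq).2
      rw [Finset.mem_filter, and_iff_right (Finset.mem_univ _)]
      have e1 : ((g * rep q : G) : G ⧸ H) = g • q := by rw [← smul_eq_mul, ← MulAction.Quotient.smul_coe, hrep]
      have hw : (g * rep q)⁻¹ * rep (g • q) ∈ H := QuotientGroup.eq.1 (by rw [e1, hrep])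
      set w := (g * rep q)⁻¹ * rep (g • q) with hwdef
      have e2 : rep (g • q) = g * rep q * w := by rw [hwdef, mul_inv_cancel_left]
      rw [e2, ← hq']
      have hwu : w * u * w⁻¹ = u := by rw [hHcomm w hw, mul_inv_cancel_right]
      calc g * rep q * w * u * (g * rep q * w)⁻¹ = g * rep q * (w * u * w⁻¹) * (rep q)⁻¹ * g⁻¹ := by group
        _ = g * (rep q * u * (rep q)⁻¹) * g⁻¹ := by rw [hwu]; group
    have hinj : Set.InjOn (fun q : G ⧸ H => g • q) ↑(Finset.univ.filter fun q : G ⧸ H => rep q * u * (rep q)⁻¹ = v) :=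
      fun q₁ _ q₂ _ h => MulAction.injective g h
    have hle := Finset.card_le_card_of_injOn _ hmap hinj
    have hdisj : Disjoint (Finset.univ.filter fun q : G ⧸ H => rep q * u * (rep q)⁻¹ = v)
        (Finset.univ.filter fun q : G ⧸ H => rep q * u * (rep q)⁻¹ = g * v * g⁻¹) := by
      rw [Finset.disjoint_filter]; intro q _ h1 h2; exact hne' (h2.symm.trans h1)
    have := Finset.card_le_univ ((Finset.univ.filter fun q : G ⧸ H => rep q * u * (rep q)⁻¹ = v) ∪
      (Finset.univ.filter fun q : G ⧸ H => rep q * u * (rep q)⁻¹ = g * v * g⁻¹))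
    rw [Finset.card_union_of_disjoint hdisj] at this
    omega
  -- (f) sizes: `|H| ≤ 4`, `|G| = |P|·|H|`
  have hH4 : Nat.card H ≤ 4 := by
    have hfin : Nat.card {x : G // x ∈ ({1, u, c, c * u} : Finset G)} ≤ 4 := by
      rw [Nat.card_eq_fintype_card, Fintype.card_coe]
      exact (Finset.card_insert_le _ _).trans (by
        refine Nat.succ_le_succ ((Finset.card_insert_le _ _).trans (Nat.succ_le_succ ?_))
        exact (Finset.card_insert_le _ _).trans (by rw [Finset.card_singleton]))
    refine le_trans (Nat.card_le_card_of_injective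
      (fun h : H => (⟨h.1, ?_⟩ : {x : G // x ∈ ({1, u, c, c * u} : Finset G)}))
      fun a b hab => Subtype.ext (by simpa using congrArg Subtype.val hab)) hfin
    rcases (hH h.1).1 h.2 with e | e | e | e <;> simp [e]
  have hGP : Nat.card G = Nat.card (G ⧸ H) * Nat.card H := Subgroup.card_eq_card_quotient_mul_card_subgroup H
  rw [Nat.card_eq_fintype_card, Nat.card_eq_fintype_card] at hGP
  set n := Fintype.card (G ⧸ H) with hndef
  have hn16 : 16 ≤ n := by
    by_contra h
    have : Fintype.card G ≤ 15 * 4 := by rw [hGP]; exact Nat.mul_le_mul (by omega) hH4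
    omega
  have hG4n : Fintype.card G ≤ 4 * n := by rw [hGP, mul_comm]; exact Nat.mul_le_mul_right _ hH4
  -- (g) the count: fibre sizes `F' v`, with `Σ_v F' v = n` and `F' v ≤ n/2`
  set F' : G → ℕ := fun v => (Finset.univ.filter fun q : G ⧸ H => rep q * u * (rep q)⁻¹ = v).card with hF'
  have hsumF : ∑ v ∈ (Finset.univ : Finset G), F' v = n := by
    rw [hndef, ← Finset.card_univ]
    exact (Finset.card_eq_sum_card_fiberwise fun q _ => Finset.mem_univ (rep q * u * (rep q)⁻¹)).symm
  have hFle : ∀ v, F' v ≤ n / 2 := fun v => by have := hfibre v; simp only [hF']; omega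
  set V := (Finset.univ : Finset G).erase 1 with hVdef
  have hVcard : V.card = Fintype.card G - 1 := by rw [hVdef, Finset.card_erase_of_mem (Finset.mem_univ _), Finset.card_univ]
  have hterm : ∀ v ∈ V, 2 ^ ((Fintype.card (G ⧸ H) + (Finset.univ.filter fun q : G ⧸ H =>
      (v • q) = q ∧ up (v * rep q) = false).card) / 2) ≤ 2 ^ ((n + F' v) / 2) := by
    intro v hv
    have hv1 : v ≠ 1 := (Finset.mem_erase.1 hv).1
    have hsub : (Finset.univ.filter fun q : G ⧸ H => (v • q) = q ∧ up (v * rep q) = false) ⊆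
        (Finset.univ.filter fun q : G ⧸ H => rep q * u * (rep q)⁻¹ = v) := by
      intro q hq
      rw [Finset.mem_filter] at hq ⊢
      exact ⟨hq.1, hfix v hv1 q hq.2.1 hq.2.2⟩
    have h1 := Finset.card_le_card hsub
    exact Nat.pow_le_pow_right two_pos (by rw [← hndef]; simp only [hF']; omega)
  -- split `V` by the value of `F'`
  have hS0 : ∑ v ∈ V.filter (fun v => F' v = 0), 2 ^ ((n + F' v) / 2) ≤ 4 * n * 2 ^ (n / 2) := by
    calc ∑ v ∈ V.filter (fun v => F' v = 0), 2 ^ ((n + F' v) / 2) = ∑ v ∈ V.filter (fun v => F' v = 0), 2 ^ (n / 2) :=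
          Finset.sum_congr rfl fun v hv => by rw [(Finset.mem_filter.1 hv).2, Nat.add_zero]
      _ = (V.filter fun v => F' v = 0).card * 2 ^ (n / 2) := by rw [Finset.sum_const, smul_eq_mul]
      _ ≤ 4 * n * 2 ^ (n / 2) := Nat.mul_le_mul_right _ (by
          have := Finset.card_le_card (Finset.filter_subset (fun v => F' v = 0) V); omega)
  have hcnt1 : ((V.filter fun v => ¬ F' v = 0).filter fun v => F' v ≤ 3).card ≤ n := by
    calc ((V.filter fun v => ¬ F' v = 0).filter fun v => F' v ≤ 3).card
        = ∑ v ∈ (V.filter fun v => ¬ F' v = 0).filter (fun v => F' v ≤ 3), 1 := by rw [Finset.card_eq_sum_ones]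
      _ ≤ ∑ v ∈ (V.filter fun v => ¬ F' v = 0).filter (fun v => F' v ≤ 3), F' v :=
          Finset.sum_le_sum fun v hv => by
            have := (Finset.mem_filter.1 (Finset.mem_filter.1 hv).1).2; omega
      _ ≤ ∑ v ∈ (Finset.univ : Finset G), F' v :=
          Finset.sum_le_sum_of_subset_of_nonneg (fun v _ => Finset.mem_univ v) fun _ _ _ => Nat.zero_le _
      _ = n := hsumF
  have hS1 : ∑ v ∈ (V.filter fun v => ¬ F' v = 0).filter (fun v => F' v ≤ 3), 2 ^ ((n + F' v) / 2) ≤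
      n * 2 ^ ((n + 3) / 2) := by
    calc ∑ v ∈ (V.filter fun v => ¬ F' v = 0).filter (fun v => F' v ≤ 3), 2 ^ ((n + F' v) / 2)
        ≤ ∑ v ∈ (V.filter fun v => ¬ F' v = 0).filter (fun v => F' v ≤ 3), 2 ^ ((n + 3) / 2) :=
          Finset.sum_le_sum fun v hv => Nat.pow_le_pow_right two_pos (by
            have := (Finset.mem_filter.1 hv).2; omega)
      _ = ((V.filter fun v => ¬ F' v = 0).filter fun v => F' v ≤ 3).card * 2 ^ ((n + 3) / 2) := by
          rw [Finset.sum_const, smul_eq_mul]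
      _ ≤ n * 2 ^ ((n + 3) / 2) := Nat.mul_le_mul_right _ hcnt1
  have hcnt2 : ((V.filter fun v => ¬ F' v = 0).filter fun v => ¬ F' v ≤ 3).card ≤ n / 4 := by
    have h4 : ((V.filter fun v => ¬ F' v = 0).filter fun v => ¬ F' v ≤ 3).card * 4 ≤ n := by
      calc ((V.filter fun v => ¬ F' v = 0).filter fun v => ¬ F' v ≤ 3).card * 4
          = ∑ v ∈ (V.filter fun v => ¬ F' v = 0).filter (fun v => ¬ F' v ≤ 3), 4 := by
            rw [Finset.sum_const, smul_eq_mul]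
        _ ≤ ∑ v ∈ (V.filter fun v => ¬ F' v = 0).filter (fun v => ¬ F' v ≤ 3), F' v :=
            Finset.sum_le_sum fun v hv => by have := (Finset.mem_filter.1 hv).2; omega
        _ ≤ ∑ v ∈ (Finset.univ : Finset G), F' v :=
            Finset.sum_le_sum_of_subset_of_nonneg (fun v _ => Finset.mem_univ v) fun _ _ _ => Nat.zero_le _
        _ = n := hsumF
    omega
  have hS2 : ∑ v ∈ (V.filter fun v => ¬ F' v = 0).filter (fun v => ¬ F' v ≤ 3), 2 ^ ((n + F' v) / 2) ≤
      n / 4 * 2 ^ ((n + n / 2) / 2) := by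
    calc ∑ v ∈ (V.filter fun v => ¬ F' v = 0).filter (fun v => ¬ F' v ≤ 3), 2 ^ ((n + F' v) / 2)
        ≤ ∑ v ∈ (V.filter fun v => ¬ F' v = 0).filter (fun v => ¬ F' v ≤ 3), 2 ^ ((n + n / 2) / 2) :=
          Finset.sum_le_sum fun v _ => Nat.pow_le_pow_right two_pos (by have := hFle v; omega)
      _ = ((V.filter fun v => ¬ F' v = 0).filter fun v => ¬ F' v ≤ 3).card * 2 ^ ((n + n / 2) / 2) := by
          rw [Finset.sum_const, smul_eq_mul]
      _ ≤ n / 4 * 2 ^ ((n + n / 2) / 2) := Nat.mul_le_mul_right _ hcnt2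
  have hcount : ∑ v ∈ V,
      2 ^ ((Fintype.card (G ⧸ H) + (Finset.univ.filter fun q : G ⧸ H =>
        (v • q) = q ∧ up (v * rep q) = false).card) / 2) < 2 ^ Fintype.card (G ⧸ H) := by
    calc ∑ v ∈ V, 2 ^ ((Fintype.card (G ⧸ H) + (Finset.univ.filter fun q : G ⧸ H =>
          (v • q) = q ∧ up (v * rep q) = false).card) / 2)
        ≤ ∑ v ∈ V, 2 ^ ((n + F' v) / 2) := Finset.sum_le_sum hterm
      _ = ∑ v ∈ V.filter (fun v => F' v = 0), 2 ^ ((n + F' v) / 2) +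
            (∑ v ∈ (V.filter fun v => ¬ F' v = 0).filter (fun v => F' v ≤ 3), 2 ^ ((n + F' v) / 2) +
             ∑ v ∈ (V.filter fun v => ¬ F' v = 0).filter (fun v => ¬ F' v ≤ 3), 2 ^ ((n + F' v) / 2)) := by
          rw [Finset.sum_filter_add_sum_filter_not, Finset.sum_filter_add_sum_filter_not]
      _ ≤ 4 * n * 2 ^ (n / 2) + (n * 2 ^ ((n + 3) / 2) + n / 4 * 2 ^ ((n + n / 2) / 2)) :=
          Nat.add_le_add hS0 (Nat.add_le_add hS1 hS2)
      _ < 2 ^ n := by have := skew_count_lt_two_pow n hn16; omega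
  -- (h) a section violating every system
  obtain ⟨ε, hε⟩ := SectionCount.exists_forall_violated_fix V
    (fun v (q : G ⧸ H) => v • q) (fun v _ => MulAction.injective v) (fun v q => up (v * rep q)) hcount
  refine ⟨Finset.univ.filter fun y : G => up y = ε (y : G ⧸ H), hTc ε, fun v hv => ?_, hTu ε⟩
  by_contra hcon
  have hcon' : ∀ x, x ∈ (Finset.univ.filter fun y : G => up y = ε (y : G ⧸ H)) ↔
      v * x ∈ (Finset.univ.filter fun y : G => up y = ε (y : G ⧸ H)) := fun x => by
    by_contra h; exact hcon ⟨x, h⟩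
  obtain ⟨q, hq⟩ := hε v (by rw [hVdef]; exact Finset.mem_erase.2 ⟨hv, Finset.mem_univ v⟩)
  exact hq (hstab ε v hcon' q)

end Summit.HodgeConjecture.CorCM.GaloisModels.SkewSection
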